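import Summits.HodgeConjecture.CorCM.D2Bridge.NotHJAlbStarBijectiveOfLemma24
import Summits.HodgeConjecture.HodgeCM.Proofs.LandherrCompact
import Literature.AlgebraicGeometry.ShimuraVarieties.UnitaryBallAlbaneseAlgebraic
import HarnessLib

set_option autoImplicit false

/-!
# R1 for the tree's pin from [Liu2021] Lemma 2.4 (1) AT PROJECTIVE `X` WITH (R-ℂ) PIECES — the consumer side of the III-0 «(G)-road»

Cell `hodgecm-mathlib`, fan A, crux `hLiu418` (stmt-HodgeConjecture-24832), row III-0.  Sequel of `NotHJAlbStarBijectiveOfLemma24.lean`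
(which derives `bijective_albStarQ_componentAlbanesePin[Total]_of_lemma24` from the named fact `Liu2021.albanese_bettiOne_pullback_bijective`
= [Liu2021, Lem. 2.4 (1)] for ALL proper smooth `X`).  THEOREMS ONLY; no `def`, no `sorry`, no named fact; (A-p18 g2, (G)-road lead).

The III-0 road of record (director g2 BATCH 59) proves Lemma 2.4 (1) NOT for every proper smooth `X` but in the shape the cone consumes:
**(Lp) «Lemma 2.4 (1) at a PROJECTIVE smooth `X / k ⊆ ℂ` whose complex pieces `Y_q` are smooth projective with `b₁(Y_q) ≤ 2·dim J(Y_q)`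
((R-ℂ), the complex Albanese dimension bound)»** — the theorem `albanese_bettiOne_pullback_bijective_of_isProjectiveOver` of
`Liu2021/Lemma24OfJacobianDimension.lean` (A-p17, from the α-compatible finite-Galois Albanese fan G1–G4 ★ p612162/p612540/p611662/p613207 and
A-p14's (R-bc) = F5).  THIS FILE re-derives the cone's R1 from (Lp), taken as the explicit hypothesis `hLp` (its ∀-closure, binder for binder),
so that the minute (Lp) lands the cone's III-0 input is a theorem:
* §1 `NotHJ.bijective_pull_desc_albOnPiece_of_lemma24Proj` — (Lp) in the `albOnPiece` currency (as §2 of the base file, with `hX : IsProjectiveOver X`,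
  `hY`, `hRC` threaded);
* §2 `LevelQReps.bijective_albStarQ_componentAlbanesePin_of_lemma24Proj` / `…PinTotal…` / `injective_…` — R1 at the pin: `X := X_K` is
  projective (✔ `projective_X`), its pieces `P V hU h₃ K (g q)` are smooth projective SURFACES (✔ `isSmoothProjective_P`) carrying ball
  uniformisation data (✔ `Var.ballDatum`, anisotropy from `4 ≤ [F:ℚ]` via ✔ `HermSpace3.isAnisotropic_iff_finrank_ne_two` and
  ✔ `isAnisotropic_pmsCode_iff`), whence (R-ℂ) by ✔ `UnitaryBallAlbaneseAlgebraic.finrank_bettiCohomology_le_two_mul_dim` (Arapura Cor. 15.4.6).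
HC_CM is proved only modulo the 7 printed citations until rung 0 closes; this file discharges nothing by itself (`hLp` is a hypothesis).

## References
* [Liu2021] Y. Liu, arXiv:2102.11518 = Camb. J. Math. 9 (2021): Lemma 2.4 (1) (FJcycle.tex l. 1210–1228), §4.2 (l. 2053–2074).
* [Arapura2012] D. Arapura, *Algebraic Geometry over the Complex Numbers*, Cor. 15.4.6 (Albanese of a compact Kähler manifold).
* [Deligne1979ShimuraVarieties] §2.1.2 (components of Shimura varieties).
-/

noncomputable section

/-! ## §1 (Lp) in the `albOnPiece` currency -/

namespace Summit.HodgeConjecture.CorCM.D2Bridge.NotHJ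

open CategoryTheory CategoryTheory.Limits AlgebraicGeometry MonoidalCategory CartesianMonoidalCategory
open Literature.AlgebraicGeometry.Motives Literature.AlgebraicGeometry.HodgeTheory
open Literature.NumberTheory.Automorphic.Liu2021 Literature.NumberTheory.Automorphic.Liu2021.AppendixC
open AbelianVariety (bcFunctor)

/-- **[Liu2021, Lem. 2.4 (1)] at projective `X` with (R-ℂ) pieces, in the `albOnPiece` currency**: from the hypothesis `hLp` (the
∀-closure of (Lp), see the module docstring), for `X / k` projective and smooth of relative dimension `d` (`k → ℂ`, char 0), an Albanese datum
`a`, a colimit cofan of geometrically irreducible SMOOTH PROJECTIVE complex pieces `inj q : Y q ⟶ X ⊗_k ℂ` with `b₁(Y q) ≤ 2 dim J` for every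
complex Albanese datum `J` of `Y q`, and base points `x q`, the pull-back along `(α_X)_x = [albOnPiece a (inj q) (x q)]_q` is bijective on
`H¹(−;ℚ)` (lift `ℓ := nablaLiftPiece`, as in `bijective_pull_desc_albOnPiece_of_lemma24`).
[cite: Liu2021, Lemma 2.4 (1) (FJcycle.tex l. 1210–1228)] -/
theorem bijective_pull_desc_albOnPiece_of_lemma24Proj
    (hLp : ∀ {k : Type} [Field k] [CharZero k] [Algebra k ℂ] {d : ℕ} (X : SchemeOver k) [SmoothOfRelativeDimension d X.hom],
      IsProjectiveOver X → ∀ (a : Albanese X) (Ξ : Type) (Y : Ξ → SchemeOver ℂ) [∀ q, GeometricallyIrreducible (Y q).hom]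
        (inj : ∀ q, Y q ⟶ (bcFunctor k ℂ).obj X) (_ : IsColimit (Cofan.mk ((bcFunctor k ℂ).obj X) inj))
        {d' : ℕ} (_ : ∀ q, IsSmoothProjective d' (Y q))
        (_ : ∀ (q : Ξ) (𝒥 : Jacobian (Y q)), Module.finrank ℚ (bettiCohomology (Y q) 1) ≤ 2 * 𝒥.J.dim)
        (x : ∀ q, AlgPoints (Y q) ℂ) (ℓ : ∀ q, Y q ⊗ Y q ⟶ (bcFunctor k ℂ).obj a.nabla.N)
        (_ : ∀ q, ℓ q ≫ (bcFunctor k ℂ).map a.nabla.incl = (inj q ⊗ₘ inj q) ≫ Functor.LaxMonoidal.μ (bcFunctor k ℂ) X X)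
        (αx : (bcFunctor k ℂ).obj X ⟶ (a.Alb.baseChange ℂ).X)
        (_ : ∀ q, inj q ≫ αx = lift (𝟙 (Y q)) (toSpecOver (Y q) ≫ x q) ≫ ℓ q ≫ (bcFunctor k ℂ).map a.α),
        Function.Bijective (BettiUniverse.pull αx 1))
    {k : Type} [Field k] [CharZero k] [Algebra k ℂ] {d : ℕ} {X : SchemeOver k} (hXs : SmoothOfRelativeDimension d X.hom)
    (hX : IsProjectiveOver X) (a : Albanese X) {Ξ : Type} (Y : Ξ → SchemeOver ℂ) [hirr : ∀ q, GeometricallyIrreducible (Y q).hom]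
    (inj : ∀ q, Y q ⟶ (bcFunctor k ℂ).obj X) (hcol : IsColimit (Cofan.mk ((bcFunctor k ℂ).obj X) inj))
    {d' : ℕ} (hY : ∀ q, IsSmoothProjective d' (Y q))
    (hRC : ∀ (q : Ξ) (𝒥 : Jacobian (Y q)), Module.finrank ℚ (bettiCohomology (Y q) 1) ≤ 2 * 𝒥.J.dim)
    (x : ∀ q, AlgPoints (Y q) ℂ) :
    Function.Bijective
      (BettiUniverse.pull (hcol.desc (Cofan.mk (a.Alb.baseChange ℂ).X fun q => albOnPiece a (inj q) (x q))) 1) := by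
  refine @hLp k _ _ _ d X hXs hX a Ξ Y hirr inj hcol d' hY hRC x (fun q => nablaLiftPiece a (inj q))
    (fun q => nablaLiftPiece_incl a (inj q)) _ fun q => ?_
  have e : inj q ≫ hcol.desc (Cofan.mk (a.Alb.baseChange ℂ).X fun q => albOnPiece a (inj q) (x q)) =
      albOnPiece a (inj q) (x q) :=
    hcol.fac (Cofan.mk (a.Alb.baseChange ℂ).X fun q => albOnPiece a (inj q) (x q)) ⟨q⟩
  refine e.trans ?_
  rw [albOnPiece_def, albPair_def]
  rfl

end Summit.HodgeConjecture.CorCM.D2Bridge.NotHJ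

/-! ## §2 R1 at the pin from (Lp): the pieces are compact ball quotients -/

namespace Summit.HodgeConjecture.CorCM.D2Bridge.LevelQReps

open Function CategoryTheory CategoryTheory.Limits AlgebraicGeometry NumberField MonoidalCategory CartesianMonoidalCategory
open Literature.AlgebraicGeometry.Motives Literature.AlgebraicGeometry.HodgeTheory Literature.AlgebraicGeometry.ShimuraVarieties
open Literature.AlgebraicGeometry.ShimuraVarieties.UnitaryCanonicalModel
open Literature.AlgebraicGeometry.Motives.AbelianVariety (Hom.baseChange)
open Literature.AlgebraicGeometry.HodgeTheory.BettiUniverse (pull pull_id)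
open Literature.NumberTheory.Automorphic Literature.NumberTheory.Automorphic.UnitaryGroup Literature.NumberTheory.Automorphic.PicardCM
open Literature.NumberTheory.Automorphic.Liu2021 Literature.NumberTheory.Automorphic.Liu2021.AppendixC
open Literature.NumberTheory.Transcendental (Arapura2012_Cor_15_4_6)
open Summit.HodgeConjecture.CorCM.Model Summit.HodgeConjecture.CorCM.HComp
open HodgeCM.Model HodgeCM.Model.LevelTranslate HodgeCM.Model.TowerLevel
open Summit.HodgeConjecture.CorCM.D2Bridge
open AbelianVariety (bcFunctor)
open Literature.NumberTheory.Automorphic.ShimuraDissection (CosetSpace)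

/-- **(R-ℂ) for the pieces of the pin**: each component `P V hU h₃ K hh` (a compact Picard modular SURFACE `Γ_h\𝔹²`, anisotropic as
`[F:ℚ] ≥ 4`) satisfies `b₁ ≤ 2 · dim J` for every complex Albanese datum `J` — Arapura Cor. 15.4.6 through the ball uniformisation datum.
[cite: Arapura2012, Cor. 15.4.6] [cite: Liu2021, Lemma 2.4 (1) proof (l. 1224–1226)] -/
theorem finrank_bettiCohomology_P_le_two_mul_dim {L : HodgeCM.CMField} {ι₁ : L →+* ℂ} (V : HodgeCM.HermSpace3 L ι₁)
    (hU : BallQuotientUniformisedDatum) (h₃ : CMAbelianVarietyRealised) (h4 : 4 ≤ Module.finrank ℚ L)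
    (K : C5.SmallLevel (K3 (pkgV V))) (hh : V.adelicFin) (𝒥 : Jacobian (P V hU h₃ K hh)) :
    Module.finrank ℚ (bettiCohomology (P V hU h₃ K hh) 1) ≤ 2 * 𝒥.J.dim := by
  have hV : HodgeCM.IsAnisotropic L V.Hm := (HodgeCM.HermSpace3.isAnisotropic_iff_finrank_ne_two V).mpr (by omega)
  exact UnitaryBallUniformisationDatum.finrank_bettiCohomology_le_two_mul_dim
    (Var.ballDatum hU h₃ (code V K hh) ((isAnisotropic_pmsCode_iff L ι₁ V _).2 hV)) 𝒥

/-- **R1 at Liu's explicit §4.2 carrier from (Lp)** — twin of `bijective_albStarQ_componentAlbanesePin_of_lemma24` with the named fact replaced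
by the projective∕(R-ℂ) shape `hLp`: `X := X_K` is projective (✔ `projective_X`) and smooth, the pieces at double-coset representatives are
smooth projective surfaces (✔ `isSmoothProjective_P`) with (R-ℂ) (`finrank_bettiCohomology_P_le_two_mul_dim`); then §1 of the base file.
[cite: Liu2021, Lemma 2.4 (1) (FJcycle.tex l. 1210–1228)] -/
theorem bijective_albStarQ_componentAlbanesePin_of_lemma24Proj
    (hLp : ∀ {k : Type} [Field k] [CharZero k] [Algebra k ℂ] {d : ℕ} (X : SchemeOver k) [SmoothOfRelativeDimension d X.hom],
      IsProjectiveOver X → ∀ (a : Albanese X) (Ξ : Type) (Y : Ξ → SchemeOver ℂ) [∀ q, GeometricallyIrreducible (Y q).hom]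
        (inj : ∀ q, Y q ⟶ (bcFunctor k ℂ).obj X) (_ : IsColimit (Cofan.mk ((bcFunctor k ℂ).obj X) inj))
        {d' : ℕ} (_ : ∀ q, IsSmoothProjective d' (Y q))
        (_ : ∀ (q : Ξ) (𝒥 : Jacobian (Y q)), Module.finrank ℚ (bettiCohomology (Y q) 1) ≤ 2 * 𝒥.J.dim)
        (x : ∀ q, AlgPoints (Y q) ℂ) (ℓ : ∀ q, Y q ⊗ Y q ⟶ (bcFunctor k ℂ).obj a.nabla.N)
        (_ : ∀ q, ℓ q ≫ (bcFunctor k ℂ).map a.nabla.incl = (inj q ⊗ₘ inj q) ≫ Functor.LaxMonoidal.μ (bcFunctor k ℂ) X X)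
        (αx : (bcFunctor k ℂ).obj X ⟶ (a.Alb.baseChange ℂ).X)
        (_ : ∀ q, inj q ≫ αx = lift (𝟙 (Y q)) (toSpecOver (Y q) ≫ x q) ≫ ℓ q ≫ (bcFunctor k ℂ).map a.α),
        Function.Bijective (BettiUniverse.pull αx 1))
    {L : HodgeCM.CMField} {ι₁ : L →+* ℂ} (V : HodgeCM.HermSpace3 L ι₁)
    (hU : BallQuotientUniformisedDatum) (h₃ : CMAbelianVarietyRealised) (h4 : 4 ≤ Module.finrank ℚ L)
    (h : exists_recordSystem) (hHD : exists_isReal_hodgeModel) [Algebra L ℂ] (hι : (algebraMap L ℂ).comp (cmConjRingHom L) = ι₁)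
    (hI : hodgePQ_independent_of_hodgeModel) (hA : Arapura2012_Cor_15_4_6) (hU7 : heckeTranslate_definedOver)
    (Φ : CMType (pkgF L)) (iso : ℕ → Prop) (K : C5.SmallLevel (K3 (pkgV V))) :
    Bijective ((componentAlbanesePin hHD hI hU h₃ hA hU7 V h h4 hι Φ iso).albStarQ K) := by
  obtain ⟨g, hg, ⟨hcol⟩⟩ := exists_representatives_isColimit_componentInj V hU h₃ h4 h hHD hι K
  rw [albStarQ_bijective_iff_pull_albTotal_bijective V hU h₃ h4 h hHD hι hI hA hU7 Φ iso K g hg hcol]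
  haveI : ∀ q, GeometricallyIrreducible (P V hU h₃ K (g q)).hom := fun q => geometricallyIrreducible_pms hU h₃ (code V K (g q))
  exact NotHJ.bijective_pull_desc_albOnPiece_of_lemma24Proj hLp (X := (compactifiedOf h (pkgV V) Φ h4).X.obj K)
    ((compactifiedOf h (pkgV V) Φ h4).smooth_X K) ((compactifiedOf h (pkgV V) Φ h4).projective_X K)
    ((sec42DataOfFourLe h (pkgV V) Φ h4 iso).alb K) (fun q => P V hU h₃ K (g q))
    (fun q => componentInj V hU h₃ h4 h hHD hι K (g q)) hcol (fun q => isSmoothProjective_P V hU h₃ K (g q))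
    (fun q 𝒥 => finrank_bettiCohomology_P_le_two_mul_dim V hU h₃ h4 K (g q) 𝒥) (fun q => basePt V hU h₃ K (g q))

/-- **R1 at the TOTAL carrier from (Lp)** — twin of `bijective_albStarQ_componentAlbanesePinTotal_of_lemma24`.
[cite: Liu2021, Lemma 2.4 (1) (FJcycle.tex l. 1210–1228); §4.2 l. 2053–2074] -/
theorem bijective_albStarQ_componentAlbanesePinTotal_of_lemma24Proj
    (hLp : ∀ {k : Type} [Field k] [CharZero k] [Algebra k ℂ] {d : ℕ} (X : SchemeOver k) [SmoothOfRelativeDimension d X.hom],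
      IsProjectiveOver X → ∀ (a : Albanese X) (Ξ : Type) (Y : Ξ → SchemeOver ℂ) [∀ q, GeometricallyIrreducible (Y q).hom]
        (inj : ∀ q, Y q ⟶ (bcFunctor k ℂ).obj X) (_ : IsColimit (Cofan.mk ((bcFunctor k ℂ).obj X) inj))
        {d' : ℕ} (_ : ∀ q, IsSmoothProjective d' (Y q))
        (_ : ∀ (q : Ξ) (𝒥 : Jacobian (Y q)), Module.finrank ℚ (bettiCohomology (Y q) 1) ≤ 2 * 𝒥.J.dim)
        (x : ∀ q, AlgPoints (Y q) ℂ) (ℓ : ∀ q, Y q ⊗ Y q ⟶ (bcFunctor k ℂ).obj a.nabla.N)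
        (_ : ∀ q, ℓ q ≫ (bcFunctor k ℂ).map a.nabla.incl = (inj q ⊗ₘ inj q) ≫ Functor.LaxMonoidal.μ (bcFunctor k ℂ) X X)
        (αx : (bcFunctor k ℂ).obj X ⟶ (a.Alb.baseChange ℂ).X)
        (_ : ∀ q, inj q ≫ αx = lift (𝟙 (Y q)) (toSpecOver (Y q) ≫ x q) ≫ ℓ q ≫ (bcFunctor k ℂ).map a.α),
        Function.Bijective (BettiUniverse.pull αx 1))
    {L : HodgeCM.CMField} {ι₁ : L →+* ℂ} (V : HodgeCM.HermSpace3 L ι₁)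
    (hU : BallQuotientUniformisedDatum) (h₃ : CMAbelianVarietyRealised) (h4 : 4 ≤ Module.finrank ℚ L)
    (h : exists_recordSystem) (hHD : exists_isReal_hodgeModel) [Algebra L ℂ] (hι : (algebraMap L ℂ).comp (cmConjRingHom L) = ι₁)
    (hI : hodgePQ_independent_of_hodgeModel) (hA : Arapura2012_Cor_15_4_6) (hU7 : heckeTranslate_definedOver)
    (Φ : CMType (pkgF L))
    (isoF : ∀ (F : Summit.HodgeConjecture.CorCM.CMField) (ι : F →+* ℂ) (_ : Summit.HodgeConjecture.CorCM.HermSpace3 F ι)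
      (_ : CMType F), ℕ → Prop) :
    ∀ K, Bijective ((componentAlbanesePinTotal hHD hI hU h₃ hA hU7 V h h4 hι Φ isoF).albStarQ K) :=
  (forall_bijective_albStarQ_pinTotal_iff V hU h₃ h4 h hHD hι hI hA hU7 Φ isoF).2
    (fun K' => bijective_albStarQ_componentAlbanesePin_of_lemma24Proj hLp V hU h₃ h4 h hHD hι hI hA hU7 Φ
      (isoF (pkgF L) ι₁ (pkgV V) Φ) K')

end Summit.HodgeConjecture.CorCM.D2Bridge.LevelQReps

end
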